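import Literature.GroupTheory.CombinatorialGroupTheory.PuncturedSurfaceGroupCusps
import Mathlib.GroupTheory.SemidirectProduct
import Mathlib.Data.Finsupp.SMul
import Mathlib.Algebra.BigOperators.Group.Finset.Basic
import Mathlib.Data.ZMod.Defs
import Mathlib.Tactic.Abel
import Mathlib.Tactic.Group
import HarnessLib

/-!
# Malnormality of the boundary cusp (`r = 1`): preliminaries

[SemiAnbd] Example 2.10 (p. 31) / [AbsAnab] Lemma 1.3.7 — abc-iut-L3-t11's named fact
`ProSigmaCuspInertiaMalnormal` (`SurfaceTypeEstranged.lean`) [cite: MochizukiSemiAnbd2006, Ex. 2.10 p.31].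
Elementary inputs of the proof of its once-punctured clause (`ProSigmaBoundaryMalnormal.lean`; engine in
`ProSigmaCuspMalnormalEngine.lean`), theorems only:

* `PuncturedSurfaceGroup.exists_aCharacter` — the character `a_{i₀} ↦ 1 ∈ ℤ/m` of `Γ_{g,r}` (kills every
  cusp), and `PuncturedSurfaceGroup.relation_map_one` — the defining relation of `Γ_{g+1,1}` with the first
  handle split off, pushed along any homomorphism;
* algebra in the permutation module `α →₀ R` with the translation action (translation components written pointwise,
  so no instance is needed): the telescoping identity `S − γ·S = δ − γ^t·δ` for
  `S = ∑_{s<t} γ^s·δ`, the commutator `[(0,ā),(β,b̄)] = (ā·β − [ā,b̄]·β, [ā,b̄])` in `(α →₀ R) ⋊ Q`, and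
  products of commutators of pure `Q`-elements.

Plain group theory; nothing here bears on [IUTchIII] Cor. 3.12.
-/

namespace Literature.GroupTheory.CombinatorialGroupTheory.PuncturedSurfaceGroup

open Multiplicative

variable {g r : ℕ}

/-- **The `a_{i₀}`-character of `Γ_{g,r}`**: a homomorphism `Γ_{g,r} → ℤ/m` (written multiplicatively)
with `a_{i₀} ↦ 1`, every other generator `↦ 0`; it kills every cusp generator (the relator maps to `0`
because the target is abelian). [cite: MochizukiSemiAnbd2006, Ex. 2.10 p.31] -/
theorem exists_aCharacter (i₀ : Fin g) (m : ℕ) :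
    ∃ φ : PuncturedSurfaceGroup g r →* Multiplicative (ZMod m),
      φ (a i₀) = ofAdd 1 ∧ ∀ j, φ (c j) = 1 := by
  classical
  let f : puncturedSurfaceGen g r → Multiplicative (ZMod m) :=
    Sum.elim (fun ib => if ib = (i₀, false) then ofAdd 1 else 1) fun _ => 1
  have hrel : ∀ v ∈ ({relator g r} : Set (FreeGroup (puncturedSurfaceGen g r))),
      FreeGroup.lift f v = 1 := by
    intro v hv
    rw [Set.mem_singleton_iff] at hv
    subst hv
    rw [lift_relator]
    have h1 : ((List.finRange g).map fun i =>
        f (Sum.inl (i, false)) * f (Sum.inl (i, true)) * (f (Sum.inl (i, false)))⁻¹ *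
          (f (Sum.inl (i, true)))⁻¹).prod = 1 :=
      List.prod_eq_one fun y hy => by
        obtain ⟨i, -, rfl⟩ := List.mem_map.mp hy
        rw [mul_inv_eq_one, mul_inv_eq_iff_eq_mul, mul_comm]
    have h2 : ((List.finRange r).map fun k => f (Sum.inr k)).prod = 1 :=
      List.prod_eq_one fun y hy => by
        obtain ⟨i, -, rfl⟩ := List.mem_map.mp hy
        rfl
    rw [h1, h2, one_mul]
  refine ⟨PresentedGroup.toGroup hrel, ?_, fun j => ?_⟩
  · rw [a, PresentedGroup.toGroup.of]
    simp [f]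
  · rw [c, PresentedGroup.toGroup.of]
    rfl

/-- The defining relation of `Γ_{g+1,1}` pushed to any group: for a homomorphism `θ : Γ_{g+1,1} → M`,
`[θa₁,θb₁] · ∏_{i≥2}[θa_i,θb_i] · θc₁ = 1`. [cite: MochizukiSemiAnbd2006, Ex. 2.10 p.31] -/
theorem relation_map_one {M : Type*} [Group M] (θ : PuncturedSurfaceGroup (g + 1) 1 →* M) :
    θ (a 0) * θ (b 0) * (θ (a 0))⁻¹ * (θ (b 0))⁻¹ *
      ((List.finRange g).map fun i =>
        θ (a i.succ) * θ (b i.succ) * (θ (a i.succ))⁻¹ * (θ (b i.succ))⁻¹).prod * θ (c 0) = 1 := by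
  let fQ : puncturedSurfaceGen (g + 1) 1 → M := fun s => θ (PresentedGroup.of s)
  have hlift : FreeGroup.lift fQ =
      θ.comp (PresentedGroup.mk ({relator (g + 1) 1} : Set (FreeGroup (puncturedSurfaceGen (g + 1) 1)))) :=
    FreeGroup.ext_hom _ _ fun s => by rw [FreeGroup.lift_apply_of]; rfl
  have h1 : FreeGroup.lift fQ (relator (g + 1) 1) = 1 := by
    rw [hlift, MonoidHom.comp_apply, PresentedGroup.one_of_mem (Set.mem_singleton _), map_one]
  rw [lift_relator, List.finRange_succ, List.map_cons, List.prod_cons, List.map_map] at h1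
  have h2 : ((List.finRange 1).map fun j => fQ (Sum.inr j)).prod = θ (c 0) := by
    simp [List.finRange_succ, fQ, c]
  rw [h2] at h1
  simp only [Function.comp_def] at h1
  exact h1

end Literature.GroupTheory.CombinatorialGroupTheory.PuncturedSurfaceGroup

namespace Literature.AnabelianGeometry.SemiGraphs.SemiGraphOfAnabelioids

open Multiplicative

/-! ### Algebra in the permutation module -/

section Module

/-- Telescoping in a module: `S − γ·S = δ − γ^t·δ` for `S = ∑_{s<t} γ^s·δ`.
[cite: MochizukiSemiAnbd2006, Ex. 2.10 p.31] -/
theorem sum_smul_pow_sub_smul {G M : Type*} [Monoid G] [AddCommGroup M] [DistribMulAction G M]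
    (γ : G) (δ : M) (t : ℕ) :
    (∑ s ∈ Finset.range t, γ ^ s • δ) - γ • ∑ s ∈ Finset.range t, γ ^ s • δ = δ - γ ^ t • δ := by
  induction t with
  | zero => simp
  | succ t ih =>
    rw [Finset.sum_range_succ, smul_add, add_sub_add_comm, ih, ← mul_smul, ← pow_succ']
    abel

variable {Q : Type*} [Group Q] {α : Type*} [MulAction Q α] {R : Type*} [AddCommGroup R]
  (τ : Q →* MulAut (Multiplicative (α →₀ R)))

/-- Conjugation in `(α →₀ R) ⋊ Q` for the translation action (local copy of the engine's
`wreath_conj_left_apply`). [cite: MochizukiSemiAnbd2006, Ex. 2.10 p.31] -/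
private theorem wreath_conj_left_apply' (hτ : ∀ (q : Q) (m : Multiplicative (α →₀ R)) (a : α),
      toAdd (τ q m) a = toAdd m (q⁻¹ • a))
    (a b : Multiplicative (α →₀ R) ⋊[τ] Q) (p : α) :
    toAdd (a * b * a⁻¹).left p =
      toAdd a.left p + toAdd b.left (a.right⁻¹ • p) -
        toAdd a.left ((a.right * b.right * a.right⁻¹)⁻¹ • p) := by
  have h1 : (a * b * a⁻¹).left =
      a.left * (τ a.right) b.left * (τ (a.right * b.right * a.right⁻¹)) a.left⁻¹ := by
    simp only [SemidirectProduct.mul_left, SemidirectProduct.mul_right,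
      SemidirectProduct.inv_left, map_mul, MulAut.mul_apply]
  rw [h1, toAdd_mul, toAdd_mul, Finsupp.add_apply, Finsupp.add_apply, hτ, map_inv, toAdd_inv,
    Finsupp.neg_apply, hτ, sub_eq_add_neg]

/-- The commutator `[(0, ā), (β, b̄)]` in `(α →₀ R) ⋊ Q` (translation action): its `Q`-component is
`[ā, b̄]` and its translation component, evaluated at a point `p`, is `β(ā⁻¹ p) − β([ā,b̄]⁻¹ p)` (that is,
`ā·β − [ā,b̄]·β`). [cite: MochizukiSemiAnbd2006, Ex. 2.10 p.31] -/
theorem wreath_commutator_inr (hτ : ∀ (q : Q) (m : Multiplicative (α →₀ R)) (p : α),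
      toAdd (τ q m) p = toAdd m (q⁻¹ • p)) (a b : Q) (β : α →₀ R) :
    ((SemidirectProduct.inr a : Multiplicative (α →₀ R) ⋊[τ] Q) *
          (⟨ofAdd β, b⟩ : Multiplicative (α →₀ R) ⋊[τ] Q) *
          (SemidirectProduct.inr a : Multiplicative (α →₀ R) ⋊[τ] Q)⁻¹ *
          (⟨ofAdd β, b⟩ : Multiplicative (α →₀ R) ⋊[τ] Q)⁻¹).right = a * b * a⁻¹ * b⁻¹ ∧
      ∀ p : α, toAdd ((SemidirectProduct.inr a : Multiplicative (α →₀ R) ⋊[τ] Q) *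
          (⟨ofAdd β, b⟩ : Multiplicative (α →₀ R) ⋊[τ] Q) *
          (SemidirectProduct.inr a : Multiplicative (α →₀ R) ⋊[τ] Q)⁻¹ *
          (⟨ofAdd β, b⟩ : Multiplicative (α →₀ R) ⋊[τ] Q)⁻¹).left p =
        β (a⁻¹ • p) - β ((a * b * a⁻¹ * b⁻¹)⁻¹ • p) := by
  refine ⟨by simp [SemidirectProduct.mul_right, SemidirectProduct.inv_right], fun p => ?_⟩
  rw [SemidirectProduct.mul_left, toAdd_mul, Finsupp.add_apply, wreath_conj_left_apply' τ hτ, hτ,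
    SemidirectProduct.inv_left, hτ]
  simp only [SemidirectProduct.left_inr, SemidirectProduct.right_inr, SemidirectProduct.mul_right,
    SemidirectProduct.inv_right, toAdd_one, Finsupp.coe_zero, Pi.zero_apply, zero_add, sub_zero,
    toAdd_inv, toAdd_ofAdd, Finsupp.neg_apply, inv_inv, ← mul_smul, ← sub_eq_add_neg]
  congr 3
  group

omit [MulAction Q α] in
/-- Products of commutators of elements of the form `(0, q)` stay of that form.
[cite: MochizukiSemiAnbd2006, Ex. 2.10 p.31] -/
theorem prod_commutator_inr {ι' : Type*} (L : List ι') (u v : ι' → Q) :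
    (L.map fun i => (SemidirectProduct.inr (u i) : Multiplicative (α →₀ R) ⋊[τ] Q) *
        SemidirectProduct.inr (v i) * (SemidirectProduct.inr (u i))⁻¹ * (SemidirectProduct.inr (v i))⁻¹).prod =
      (SemidirectProduct.inr ((L.map fun i => u i * v i * (u i)⁻¹ * (v i)⁻¹).prod) :
        Multiplicative (α →₀ R) ⋊[τ] Q) := by
  induction L with
  | nil => simp
  | cons i L ih => simp only [List.map_cons, List.prod_cons, ih, map_mul, map_inv]

end Module

end Literature.AnabelianGeometry.SemiGraphs.SemiGraphOfAnabelioids
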